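import Summits.AtomisticToContinuum.FouriersLaw.Theorems.OddSectorIrreversibilityOddDensityIsCorrectorRegularity
import Summits.AtomisticToContinuum.FouriersLaw.Theorems.OddSectorIrreversibilityOddDensityIsCorrectorAdjoint
import Summits.AtomisticToContinuum.FouriersLaw.Theorems.OddSectorIrreversibilityOddDensityIsCorrectorDissipativity

/-!
# `OddDensityIsCorrector`, part 5: `Range(λ - L)|C_c^∞` is dense in `L²(μ_T)`

Helper file for support item `stmt-AtomisticToContinuum-9146`
(`OddSectorIrreversibility.OddDensityIsCorrector`).

For the pinned anharmonic chain (all parameters `> 0`, `N ≥ 2`, `T > 0`) and `λ > 0`, the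
equilibrium generator `L = L_{T,T}` on test functions is essentially m-dissipative in `L²(μ_T)`:

* `ae_eq_zero_of_weak_resolvent` — an `L²(μ_T)` function orthogonal to `(λ - L)C_c^∞` vanishes:
  it is a.e. a smooth `g` (hypoellipticity, `exists_contDiff_ae_eq_of_weak_resolvent`); by the
  generator-level detailed balance `L† = ΘLΘ` (`integral_generator_mul_eq_reversal`) `g∘Θ` is a
  classical `L²(e^{-H/T})` solution of `L(g∘Θ) = λ (g∘Θ)`, hence zero (`eq_zero_of_generator_eq_smul`);
* `exists_testFunction_resolvent_approx` — the subspace `(λ - L)C_c^∞` of `L²(μ_T)` is dense,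
  in working form: every `f ∈ L²(μ_T)` is, for every `ε > 0`, within `ε` of some `λF - LF`,
  `F ∈ C_c^∞`, in `L²(μ_T)`.

Nothing here closes an item.
-/

noncomputable section

open MeasureTheory Filter Topology Set Function
open scoped ContDiff ENNReal InnerProductSpace
open Literature.MathematicalPhysics.KineticTheory.HeatConduction
open Summit.AtomisticToContinuum.FouriersLaw.Theorems.SubdiffusiveBondHeat

namespace Summit.AtomisticToContinuum.FouriersLaw.Theorems.OddSectorIrreversibility

variable {N : ℕ}

/-! ### Linearity of the generator on `C²` -/

/-- `∂_{q_i}(f + g) = ∂_{q_i} f + ∂_{q_i} g` for differentiable `f, g`. [folklore] -/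
theorem partialQ_add {f g : PhaseSpace N → ℝ} (hf : Differentiable ℝ f) (hg : Differentiable ℝ g)
    (i : Fin N) (x : PhaseSpace N) :
    partialQ i (fun y => f y + g y) x = partialQ i f x + partialQ i g x := by
  have hfg : Differentiable ℝ (fun y => f y + g y) := hf.add hg
  rw [partialQ_eq_fderiv hfg, partialQ_eq_fderiv hf, partialQ_eq_fderiv hg]
  simp only
  rw [fderiv_fun_add (hf x) (hg x)]
  rfl

/-- `∂_{p_i}(f + g) = ∂_{p_i} f + ∂_{p_i} g` for differentiable `f, g`. [folklore] -/
theorem partialP_add {f g : PhaseSpace N → ℝ} (hf : Differentiable ℝ f) (hg : Differentiable ℝ g)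
    (i : Fin N) (x : PhaseSpace N) :
    partialP i (fun y => f y + g y) x = partialP i f x + partialP i g x := by
  have hfg : Differentiable ℝ (fun y => f y + g y) := hf.add hg
  rw [partialP_eq_fderiv hfg, partialP_eq_fderiv hf, partialP_eq_fderiv hg]
  simp only
  rw [fderiv_fun_add (hf x) (hg x)]
  rfl

/-- `∂_{q_i}(c f) = c ∂_{q_i} f`. [folklore] -/
theorem partialQ_const_mul (c : ℝ) (f : PhaseSpace N → ℝ) (i : Fin N) (x : PhaseSpace N) :
    partialQ i (fun y => c * f y) x = c * partialQ i f x := by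
  unfold partialQ
  exact deriv_const_mul_field c

/-- `∂_{p_i}(c f) = c ∂_{p_i} f`. [folklore] -/
theorem partialP_const_mul (c : ℝ) (f : PhaseSpace N → ℝ) (i : Fin N) (x : PhaseSpace N) :
    partialP i (fun y => c * f y) x = c * partialP i f x := by
  unfold partialP
  exact deriv_const_mul_field c

/-- **Additivity of the generator** on `C²` functions. [folklore] -/
theorem generator_add (P : OscillatorChain) (N : ℕ) (T_L T_R : ℝ) {f g : PhaseSpace N → ℝ}
    (hf : ContDiff ℝ 2 f) (hg : ContDiff ℝ 2 g) (x : PhaseSpace N) :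
    P.generator N T_L T_R (fun y => f y + g y) x = P.generator N T_L T_R f x + P.generator N T_L T_R g x := by
  have hfd : Differentiable ℝ f := hf.differentiable two_ne_zero
  have hgd : Differentiable ℝ g := hg.differentiable two_ne_zero
  have hf1 : ∀ i, Differentiable ℝ (partialP i f) := fun i =>
    (contDiff_partialP hf (m := 1) (by norm_num) i).differentiable one_ne_zero
  have hg1 : ∀ i, Differentiable ℝ (partialP i g) := fun i =>
    (contDiff_partialP hg (m := 1) (by norm_num) i).differentiable one_ne_zero
  have e1 : ∀ i, partialQ i (fun y => f y + g y) x = partialQ i f x + partialQ i g x :=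
    fun i => partialQ_add hfd hgd i x
  have e2 : ∀ i y, partialP i (fun y => f y + g y) y = partialP i f y + partialP i g y :=
    fun i y => partialP_add hfd hgd i y
  have e3 : ∀ i, partialP i (partialP i (fun y => f y + g y)) x =
      partialP i (partialP i f) x + partialP i (partialP i g) x := by
    intro i
    have : partialP i (fun y => f y + g y) = fun y => partialP i f y + partialP i g y := funext (e2 i)
    rw [this, partialP_add (hf1 i) (hg1 i)]
  unfold OscillatorChain.generator
  simp only [e1, e2, e3]
  rw [add_add_add_comm, ← Finset.sum_add_distrib, ← mul_add, ← Finset.sum_add_distrib]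
  congr 1
  · exact Finset.sum_congr rfl fun i _ => by ring
  · congr 1
    refine Finset.sum_congr rfl fun i _ => ?_
    split_ifs <;> ring

/-- **Homogeneity of the generator**. [folklore] -/
theorem generator_const_mul (P : OscillatorChain) (N : ℕ) (T_L T_R : ℝ) (c : ℝ) (f : PhaseSpace N → ℝ)
    (x : PhaseSpace N) :
    P.generator N T_L T_R (fun y => c * f y) x = c * P.generator N T_L T_R f x := by
  have e1 : ∀ i, partialQ i (fun y => c * f y) x = c * partialQ i f x := fun i => partialQ_const_mul c f i x
  have e2 : ∀ i y, partialP i (fun y => c * f y) y = c * partialP i f y := fun i y => partialP_const_mul c f i y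
  have e3 : ∀ i, partialP i (partialP i (fun y => c * f y)) x = c * partialP i (partialP i f) x := by
    intro i
    have : partialP i (fun y => c * f y) = fun y => c * partialP i f y := funext (e2 i)
    rw [this, partialP_const_mul]
  unfold OscillatorChain.generator
  simp only [e1, e2, e3]
  have hA : (∑ i, (x.2 i * (c * partialQ i f x) - partialQ i (P.hamiltonian N) x * (c * partialP i f x))) =
      c * ∑ i, (x.2 i * partialQ i f x - partialQ i (P.hamiltonian N) x * partialP i f x) := by
    rw [Finset.mul_sum]
    exact Finset.sum_congr rfl fun i _ => by ring
  have hB : (∑ i, ((if i.val = 0 then T_L * (c * partialP i (partialP i f) x) - x.2 i * (c * partialP i f x) else 0) +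
      (if i.val = N - 1 then T_R * (c * partialP i (partialP i f) x) - x.2 i * (c * partialP i f x) else 0))) =
      c * ∑ i, ((if i.val = 0 then T_L * partialP i (partialP i f) x - x.2 i * partialP i f x else 0) +
        (if i.val = N - 1 then T_R * partialP i (partialP i f) x - x.2 i * partialP i f x else 0)) := by
    rw [Finset.mul_sum]
    refine Finset.sum_congr rfl fun i _ => ?_
    split_ifs <;> ring
  rw [hA, hB]
  ring

/-! ### Weak solutions orthogonal to `(λ - L)C_c^∞` vanish -/

section Pinned

variable {ω₂ lam β γ : ℝ} (hω : 0 < ω₂) (hl : 0 ≤ lam) (hβ : 0 ≤ β) (hγ : 0 < γ) (hN : 2 ≤ N)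
  {T : ℝ} (hT : 0 < T)
include hω hl hβ hγ hN hT

/-- **An `L²(μ_T)` function orthogonal to `(λ - L)C_c^∞` is zero** (`λ > 0`): for the pinned
anharmonic chain at equilibrium, if `k ∈ L²(μ_T)` is measurable and `∫ (λF - LF) k dμ_T = 0` for all
test functions `F`, then `k = 0` a.e. Hypoellipticity makes `k` a.e. equal to a smooth `g`; the
generator-level detailed balance `L† = ΘLΘ` makes `g∘Θ` a classical solution of
`L(g∘Θ) = λ g∘Θ` in `L²(e^{-H/T})`; the dissipativity estimate kills it.
[cite: Hormander1967, Thm 1.1] [cite: KunduDharNarayan2009, eq. (reln2)] -/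
theorem ae_eq_zero_of_weak_resolvent {lam' : ℝ} (hlam : 0 < lam') {k : PhaseSpace N → ℝ}
    (hkm : Measurable k) (hk : MemLp k 2 ((pinnedChain ω₂ lam β γ).gibbsMeasure N T))
    (hweak : ∀ F : PhaseSpace N → ℝ, ContDiff ℝ ∞ F → HasCompactSupport F →
      ∫ x, (lam' * F x - (pinnedChain ω₂ lam β γ).generator N T T F x) * k x
        ∂((pinnedChain ω₂ lam β γ).gibbsMeasure N T) = 0) :
    k =ᵐ[(pinnedChain ω₂ lam β γ).gibbsMeasure N T] 0 := by
  set P := pinnedChain ω₂ lam β γ with hP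
  set π := P.gibbsMeasure N T with hπ
  set ρ := P.gibbsDensity N T with hρ
  have hU1 : ContDiff ℝ 1 P.U := pinnedChain_contDiff_U ω₂ lam β γ
  have hV1 : ContDiff ℝ 1 P.V := pinnedChain_contDiff_V ω₂ lam β γ
  have hN0 : 0 < N := by omega
  haveI : IsProbabilityMeasure π := pinnedChain_isProbabilityMeasure_gibbsMeasure hω hl hβ γ N hT
  have hρc : Continuous ρ := pinnedChain_continuous_gibbsDensity ω₂ lam β γ N T
  have hρpos : ∀ x, 0 < ρ x := fun x => P.gibbsDensity_pos N T x
  have hint : Integrable ρ := pinnedChain_integrable_gibbsDensity hω hl hβ γ N hT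
  have hZpos : 0 < ∫ x, ρ x := integral_exp_pos hint
  -- smooth representative
  obtain ⟨g, hg, hvol, hae⟩ := exists_contDiff_ae_eq_of_weak_resolvent hω hl hβ hγ hN0 hT lam' hkm
    (hk.integrable one_le_two) hweak
  have hg2 : ContDiff ℝ 2 g := hg.of_le (by norm_cast)
  -- the reversed function `ĝ = g∘Θ`
  set gr : PhaseSpace N → ℝ := fun y => g (y.1, -y.2) with hgr
  have hΘs : ContDiff ℝ ∞ (fun y : PhaseSpace N => ((y.1, -y.2) : PhaseSpace N)) :=
    contDiff_fst.prodMk contDiff_snd.neg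
  have hgrs : ContDiff ℝ ∞ gr := hg.comp hΘs
  have hgr2 : ContDiff ℝ 2 gr := hgrs.of_le (by norm_cast)
  -- the pointwise equation `L ĝ = λ ĝ`, read at `Θx`: `∫ F · (λ g - (Lĝ)∘Θ) ρ = 0` for all tests
  set c : PhaseSpace N → ℝ := fun x : PhaseSpace N => lam' * g x - P.generator N T T gr (x.1, -x.2) with hc
  have hcc : Continuous c := by
    refine (continuous_const.mul hg.continuous).sub ?_
    exact (P.continuous_generator hU1 hV1 N T T hgr2).comp (continuous_fst.prodMk continuous_snd.neg)
  have hc0 : ∀ F : PhaseSpace N → ℝ, ContDiff ℝ ∞ F → HasCompactSupport F → ∫ x, F x * (c x * ρ x) = 0 := by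
    intro F hF hFc
    have hF2 : ContDiff ℝ 2 F := hF.of_le (by norm_cast)
    have h0 := hweak F hF hFc
    have h1 : ∫ x, (lam' * F x - P.generator N T T F x) * g x ∂π = 0 := by
      rw [← h0]
      exact integral_congr_ae (by filter_upwards [hae] with x hx; rw [hx])
    rw [P.integral_gibbsMeasure, mul_eq_zero] at h1
    rcases h1 with h1 | h1
    · exact absurd h1 (inv_ne_zero hZpos.ne')
    -- split `∫ (λF - LF) g ρ = λ ∫ F g ρ - ∫ (LF) g ρ` and use the adjoint identity on the second
    have hadj := integral_generator_mul_eq_reversal P hU1 hV1 N T hT.ne' hF2 hFc hg2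
    have hLc : Continuous (P.generator N T T F) := P.continuous_generator hU1 hV1 N T T hF2
    have hLs : HasCompactSupport (P.generator N T T F) := P.hasCompactSupport_generator N T T hF2 hFc
    have iA : Integrable fun x => lam' * F x * g x * ρ x :=
      (((continuous_const.mul hF.continuous).mul hg.continuous).mul hρc).integrable_of_hasCompactSupport
        (hFc.mul_left.mul_right.mul_right)
    have iB : Integrable fun x => P.generator N T T F x * g x * ρ x :=
      ((hLc.mul hg.continuous).mul hρc).integrable_of_hasCompactSupport (hLs.mul_right.mul_right)
    have hsplit : (fun x => (lam' * F x - P.generator N T T F x) * g x * ρ x) =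
        fun x => lam' * F x * g x * ρ x - P.generator N T T F x * g x * ρ x := by funext x; ring
    rw [hsplit, integral_sub iA iB, hadj, ← integral_sub iA] at h1
    · rw [← h1]
      exact integral_congr_ae (Eventually.of_forall fun x => by simp only [hc, hgr]; ring)
    · have hLgc : Continuous fun x : PhaseSpace N => P.generator N T T gr (x.1, -x.2) :=
        (P.continuous_generator hU1 hV1 N T T hgr2).comp (continuous_fst.prodMk continuous_snd.neg)
      exact ((hF.continuous.mul hLgc).mul hρc).integrable_of_hasCompactSupport (hFc.mul_right.mul_right)
  -- hence `c ρ = 0` a.e., so `c = 0` (continuity)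
  haveI := isAddHaarMeasure_volume_phaseSpace N
  have hcρ : ∀ᵐ x ∂volume, c x * ρ x = 0 :=
    ae_eq_zero_of_integral_contDiff_smul_eq_zero (hcc.mul hρc).locallyIntegrable fun F hF hFc => by
      simpa only [smul_eq_mul] using hc0 F hF hFc
  have hcρ0 : (fun x => c x * ρ x) = fun _ => 0 :=
    (Continuous.ae_eq_iff_eq volume (hcc.mul hρc) continuous_const).1
      (by filter_upwards [hcρ] with x hx; exact hx)
  have hc00 : ∀ x, c x = 0 := fun x => by
    have := congrFun hcρ0 x
    simp only [mul_eq_zero] at this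
    exact this.resolve_right (hρpos x).ne'
  have hgen : ∀ y, P.generator N T T gr y = lam' * gr y := by
    intro y
    have := hc00 (y.1, -y.2)
    simp only [hc, hgr, neg_neg, Prod.mk.eta, sub_eq_zero] at this
    exact this.symm
  -- `ĝ ∈ L²(e^{-H/T})`
  have hg2int : Integrable (fun x => g x ^ 2 * ρ x) := by
    have h1 : Integrable (fun x => g x ^ 2) π :=
      hk.integrable_sq.congr (by filter_upwards [hae] with x hx; rw [hx])
    rw [hπ, P.gibbsMeasure_eq_smul_withDensity hint, integrable_smul_measure] at h1
    · rw [integrable_withDensity_iff_integrable_smul' hρc.measurable.ennreal_ofReal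
        (Eventually.of_forall fun _ => ENNReal.ofReal_lt_top)] at h1
      refine h1.congr (Eventually.of_forall fun x => ?_)
      simp only [smul_eq_mul, ENNReal.toReal_ofReal (hρpos x).le, mul_comm]
    · exact ENNReal.inv_ne_zero.2 (P.partitionFunction_ne_top hint)
    · exact ENNReal.inv_ne_top.2 (P.partitionFunction_ne_zero hρc)
  have hgr2int : Integrable (fun x => gr x ^ 2 * ρ x) := by
    have hmp := measurePreserving_momentumReversal N
    have h : Integrable ((fun x => g x ^ 2 * ρ x) ∘ momentumReversal N) :=
      (hmp.integrable_comp (((hg.continuous.pow 2).mul hρc).aestronglyMeasurable)).2 hg2int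
    refine h.congr (Eventually.of_forall fun x => ?_)
    have hρΘ : ρ (x.1, -x.2) = ρ x := by
      simp only [hρ, OscillatorChain.gibbsDensity, OscillatorChain.hamiltonian_neg_momentum]
    simp only [Function.comp_apply, momentumReversal_apply, hgr, hρΘ]
  -- dissipativity kills `ĝ`, hence `g`, hence `k`
  have hgr0 := eq_zero_of_generator_eq_smul hω hl hβ hγ.le hN hT hlam hgr2 hgr2int hgen
  have hg0 : ∀ x, g x = 0 := fun x => by
    have := hgr0 (x.1, -x.2)
    simpa [hgr] using this
  filter_upwards [hae] with x hx
  rw [hx, hg0 x, Pi.zero_apply]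

/-! ### The range of `λ - L` on test functions, as a dense subspace of `L²(μ_T)` -/

omit hω hl hβ hγ hN hT in
/-- `λF - LF` is in `L²(μ_T)` for a test function `F` (bounded, continuous, compact support).
[folklore] -/
theorem memLp_resolvent_testFunction (lam' : ℝ) {F : PhaseSpace N → ℝ} (hF : ContDiff ℝ ∞ F)
    (hFc : HasCompactSupport F) :
    MemLp (fun x => lam' * F x - (pinnedChain ω₂ lam β γ).generator N T T F x) 2
      ((pinnedChain ω₂ lam β γ).gibbsMeasure N T) := by
  set P := pinnedChain ω₂ lam β γ
  have hF2 : ContDiff ℝ 2 F := hF.of_le (by norm_cast)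
  have hc : Continuous fun x => lam' * F x - P.generator N T T F x :=
    (continuous_const.mul hF.continuous).sub
      (P.continuous_generator (pinnedChain_contDiff_U ω₂ lam β γ) (pinnedChain_contDiff_V ω₂ lam β γ) N T T hF2)
  have hs : HasCompactSupport fun x => lam' * F x - P.generator N T T F x :=
    (hFc.mul_left).sub (P.hasCompactSupport_generator N T T hF2 hFc)
  obtain ⟨C, hC⟩ := hc.bounded_above_of_compact_support hs
  haveI : IsFiniteMeasure (P.gibbsMeasure N T) := by
    rw [OscillatorChain.gibbsMeasure]; infer_instance
  exact MemLp.of_bound hc.aestronglyMeasurable C (Eventually.of_forall hC)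

/-- **`(λ - L)C_c^∞` is dense in `L²(μ_T)`, working form** (`λ > 0`; essential m-dissipativity of the
equilibrium generator on test functions): for every `f ∈ L²(μ_T)` and `ε > 0` there is a test
function `F` with `∫ (f - (λF - LF))² dμ_T ≤ ε`. The subspace `(λ - L)C_c^∞ ⊂ Lp ℝ 2 μ_T` is a
submodule (linearity of `L`) whose orthogonal complement is trivial by `ae_eq_zero_of_weak_resolvent`.
[folklore] -/
theorem exists_testFunction_resolvent_approx {lam' : ℝ} (hlam : 0 < lam') {f : PhaseSpace N → ℝ}
    (hf : MemLp f 2 ((pinnedChain ω₂ lam β γ).gibbsMeasure N T)) {ε : ℝ} (hε : 0 < ε) :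
    ∃ F : PhaseSpace N → ℝ, ContDiff ℝ ∞ F ∧ HasCompactSupport F ∧
      ∫ x, (f x - (lam' * F x - (pinnedChain ω₂ lam β γ).generator N T T F x)) ^ 2
        ∂((pinnedChain ω₂ lam β γ).gibbsMeasure N T) ≤ ε := by
  set P := pinnedChain ω₂ lam β γ with hP
  set π := P.gibbsMeasure N T with hπ
  -- the subspace `(λ - L)C_c^∞` of `Lp ℝ 2 μ_T`
  let S : Submodule ℝ (Lp ℝ 2 π) :=
    { carrier := {v | ∃ (F : PhaseSpace N → ℝ) (hF : ContDiff ℝ ∞ F) (hFc : HasCompactSupport F),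
        v = (memLp_resolvent_testFunction (ω₂ := ω₂) (lam := lam) (β := β) (γ := γ) (N := N) (T := T)
          lam' hF hFc).toLp _}
      zero_mem' := ⟨fun _ => 0, contDiff_const, HasCompactSupport.zero, by
        symm
        rw [Lp.eq_zero_iff_ae_eq_zero]
        refine (MemLp.coeFn_toLp _).trans (Eventually.of_forall fun x => ?_)
        simp only [mul_zero, OscillatorChain.generator_const, sub_zero, Pi.zero_apply]⟩
      add_mem' := by
        rintro v w ⟨F, hF, hFc, rfl⟩ ⟨G, hG, hGc, rfl⟩
        refine ⟨fun x => F x + G x, hF.add hG, hFc.add hGc, ?_⟩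
        rw [← MemLp.toLp_add]
        congr 1
        funext x
        rw [Pi.add_apply, generator_add _ N T T (hF.of_le (by norm_cast)) (hG.of_le (by norm_cast))]
        ring
      smul_mem' := by
        rintro c v ⟨F, hF, hFc, rfl⟩
        refine ⟨fun x => c * F x, contDiff_const.mul hF, hFc.mul_left, ?_⟩
        rw [← MemLp.toLp_const_smul]
        congr 1
        funext x
        rw [generator_const_mul]
        simp only [Pi.smul_apply, smul_eq_mul]
        ring }
  -- it is dense: its orthogonal complement is trivial
  have hdense : S.topologicalClosure = ⊤ := by
    rw [Submodule.topologicalClosure_eq_top_iff, Submodule.eq_bot_iff]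
    intro w hw
    rw [Submodule.mem_orthogonal'] at hw
    -- a measurable representative of `w`
    have hwm : MemLp w 2 π := Lp.memLp w
    set k : PhaseSpace N → ℝ := hwm.1.mk w with hk
    have hkm : Measurable k := hwm.1.stronglyMeasurable_mk.measurable
    have hwk : (w : PhaseSpace N → ℝ) =ᵐ[π] k := hwm.1.ae_eq_mk
    have hkL : MemLp k 2 π := hwm.ae_eq hwk
    have hweak : ∀ F : PhaseSpace N → ℝ, ContDiff ℝ ∞ F → HasCompactSupport F →
        ∫ x, (lam' * F x - P.generator N T T F x) * k x ∂π = 0 := by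
      intro F hF hFc
      have hFS : (memLp_resolvent_testFunction (ω₂ := ω₂) (lam := lam) (β := β) (γ := γ) (N := N) (T := T)
          lam' hF hFc).toLp _ ∈ S := ⟨F, hF, hFc, rfl⟩
      have h := hw _ hFS
      rw [L2.inner_def] at h
      rw [← h]
      refine integral_congr_ae ?_
      filter_upwards [hwk, MemLp.coeFn_toLp (memLp_resolvent_testFunction (ω₂ := ω₂) (lam := lam) (β := β)
        (γ := γ) (N := N) (T := T) lam' hF hFc)] with x hx hv
      rw [hv, ← hx]
      simp only [RCLike.inner_apply, conj_trivial]
      ring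
    have h0 := ae_eq_zero_of_weak_resolvent hω hl hβ hγ hN hT hlam hkm hkL hweak
    rw [Lp.eq_zero_iff_ae_eq_zero]
    exact hwk.trans h0
  have hmem : hf.toLp f ∈ S.topologicalClosure := by
    rw [hdense]; trivial
  have hmem' : hf.toLp f ∈ closure (S : Set (Lp ℝ 2 π)) := by
    rw [← Submodule.topologicalClosure_coe]; exact hmem
  rw [Metric.mem_closure_iff] at hmem'
  obtain ⟨v, ⟨F, hF, hFc, rfl⟩, hdist⟩ := hmem' (Real.sqrt ε) (Real.sqrt_pos.2 hε)
  refine ⟨F, hF, hFc, ?_⟩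
  set G : PhaseSpace N → ℝ := fun x => lam' * F x - P.generator N T T F x with hG
  have hGm : MemLp G 2 π := memLp_resolvent_testFunction (ω₂ := ω₂) (lam := lam) (β := β) (γ := γ)
    (N := N) (T := T) lam' hF hFc
  have hsub : MemLp (f - G) 2 π := hf.sub hGm
  -- `‖toLp f - toLp G‖² = ∫ (f - G)²`
  have hnorm : ‖hf.toLp f - hGm.toLp G‖ ^ 2 = ∫ x, (f x - G x) ^ 2 ∂π := by
    rw [← MemLp.toLp_sub, ← real_inner_self_eq_norm_sq, L2.inner_def]
    refine integral_congr_ae ?_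
    filter_upwards [MemLp.coeFn_toLp hsub] with x hx
    rw [hx]
    simp only [RCLike.inner_apply, conj_trivial, Pi.sub_apply]
    ring
  rw [dist_eq_norm] at hdist
  have h2 : ‖hf.toLp f - hGm.toLp G‖ ^ 2 < ε := by
    calc ‖hf.toLp f - hGm.toLp G‖ ^ 2 < (Real.sqrt ε) ^ 2 := by gcongr
      _ = ε := Real.sq_sqrt hε.le
  rw [hnorm] at h2
  exact h2.le

end Pinned

end Summit.AtomisticToContinuum.FouriersLaw.Theorems.OddSectorIrreversibility

end
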